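import Mathlib.GroupTheory.SpecificGroups.Alternating
import Literature.InformationTheory.QuantumCodes.TwoBlockGroupAlgebraCodes
import Literature.InformationTheory.QuantumCodes.CSSParameters
import Literature.InformationTheory.QuantumCodes.TwoBlockCodeDimension
import HarnessLib

/-!
# The non-abelian two-block code `LP[1+x+y+x⁻¹yx, 1+x+y+yx]` over `𝔽₂[A₄]` has distance `2`
# (printed as `[[24,5,3]]` in Lin–Pryadko 2024, Example 11, and Wang–Lin–Pryadko 2023, Example 2)

Sources, read on the page.

* H.-K. Lin, L. P. Pryadko, *Quantum two-block group algebra codes*, PRA **109** (2024) 022407 =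
  arXiv:2306.16400 [LinPryadko2024], §IV.E Example 11 (held tex chunk p0011 L76–83): "Consider the
  alternating group `A₄`, also known as the rotation group `T` of a regular tetrahedron,
  `T = ⟨x, y | x³ = (yx)³ = y² = 1⟩`, `|T| = 12`, and the binary algebra `𝔽₂[T]`. Select
  `a = 1 + x + y + x⁻¹yx` and `b = 1 + x + y + yx` to get a 2BGA code `LP[a,b]` with parameters
  `[[24,5,3]]₂`."
* R. Wang, H.-K. Lin, L. P. Pryadko, *Abelian and non-abelian quantum two-block codes*, ISTC 2023 =
  arXiv:2305.06890 [WangLinPryadko2023], Example 2 (held tex chunk p0006 L33–41): the same `a, b`,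
  "an essentially non-abelian 2BGA code `LP[a,b]` with parameters `[[24,5,3]]₂`".
* The construction `LP[a,b] = CSS(H_X = [L(a)|R(b)], H_Z = [R(b)ᵀ|L(a)ᵀ])` is [LinPryadko2024, §IV.A
  eq. (10)] = the tree's `TwoBlockGA.css` (`TwoBlockGroupAlgebraCodes.lean`).

## What is PROVED here (kernel-checked by `decide` over Mathlib's `alternatingGroup (Fin 4)`)

With `x = (0 1 2)`, `y = (0 1)(2 3)` — which satisfy the printed presentation and generate `A₄`
(`relations`, `generates`) — and the printed `a`, `b` (weights `4`, `4`):

* `b = (1 + y)(1 + x)`, so the weight-2 `Z`-type vector `v = (0 | 1 + y)` satisfies `H_X v = 0`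
  (`v_mem_ker`), and it is NOT a `Z`-stabilizer (`v_not_mem_rowSpace`, by the dual witness
  `t = (1 + xyx | 1 + yx + xyx)`, `H_Z t = 0`, `⟨t, v⟩ = 1`); every column of `H_X` is non-zero, so no
  weight-1 `Z`-logical exists. Hence **`d_Z(LP[a,b]) = 2`** (`dZ_eq_two`).
* `w = (1 + x²y + yx | 0)` is an `X`-logical of weight `3` (`dX_le_three`), and `2 ≤ d_X` (`two_le_dX`).
* Therefore the code is an `[[24, k, 2]]` code for its own `k > 0` (`isCode_two`), and
  **it is not an `[[n, k, d]]` code for any `d ≥ 3`** (`not_isCode_of_three_le`) — in particular not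
  `[[24, 5, 3]]`.
* `rank H_X = 10`, `rank H_Z = 9` (`rank_HX`, `rank_HZ`, by `decide`d rank certificates: a
  factorisation `H = M (U H)` through `Fin r` and a pivot selection with `(U H) S = 1_r`), so
  **`k = 5` as printed** (`k_eq_five`; `rank H_X ≠ rank H_Z` is the "essentially non-abelian" feature
  `δ_X ≠ δ_Z` the example was chosen for) and **the code is `[[24, 5, 2]]`** (`isCode_24_5_2`).
* In the corrected dimension theory of `TwoBlockCodeDimension.lean`: `rank A = 9`, `rank B = 5`,
  `rank AB = 4` (`block_ranks`), so `k_S = 2` (`kS_eq_two`) and `(δ_X, δ_Z) = (0, 1)` (`defects`):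
  the example does have `δ_X ≠ δ_Z`, and `k = 2·2 + 0 + 1 = 5`.

An exhaustive search (qec-lit-3 g4, `lit/evidence/A4_2BGA_allpairs_lit3g4.py`, not part of this file)
finds that EVERY pair of weight-4 elements `a, b ∈ 𝔽₂[A₄]` with `k(LP[a,b]) = 5` has
`{d_X, d_Z} = {2, 3}`: no weight-(4,4) `[[24,5,3]]` 2BGA code on `A₄` exists in this construction.
-/

namespace Literature.InformationTheory.QuantumCodes

namespace TwoBlockGA

namespace ExampleA4

open Equiv Matrix

/-- The group `T = A₄` of the example, as Mathlib's alternating group on `Fin 4`.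
[cite: LinPryadko2024, §IV.E Example 11 (arXiv:2306.16400 chunk p0011 L76–80)] -/
abbrev T : Type := ↥(alternatingGroup (Fin 4))

/-- `x = (0 1 2)` (so `x 0 = 1`, `x 1 = 2`, `x 2 = 0`). [cite: LinPryadko2024, §IV.E Example 11 (arXiv:2306.16400 chunk p0011 L78–79)] -/
def x : T := ⟨swap 0 2 * swap 0 1, Perm.mem_alternatingGroup.mpr (by decide)⟩

/-- `y = (0 1)(2 3)`. [cite: LinPryadko2024, §IV.E Example 11 (arXiv:2306.16400 chunk p0011 L78–79)] -/
def y : T := ⟨swap 0 1 * swap 2 3, Perm.mem_alternatingGroup.mpr (by decide)⟩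

/-- The printed presentation `x³ = (yx)³ = y² = 1` holds (with `x, y ≠ 1`).
[cite: LinPryadko2024, §IV.E Example 11 "T = ⟨x,y | x³ = (yx)³ = y² = 1⟩, |T| = 12" (arXiv:2306.16400 chunk p0011 L78–79)] -/
theorem relations : x ^ 3 = 1 ∧ (y * x) ^ 3 = 1 ∧ y ^ 2 = 1 ∧ x ≠ 1 ∧ y ≠ 1 := by decide

/-- `x, y` generate `T`: the twelve elements are `1, x, x², y, xy, yx, x²y, yx², xyx, yxy, x²yx, xyx²`,
and `|T| = 12`. [cite: LinPryadko2024, §IV.E Example 11 "|T| = 12" (arXiv:2306.16400 chunk p0011 L78–79)] -/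
theorem generates : Fintype.card T = 12 ∧ ∀ g : T, g = 1 ∨ g = x ∨ g = x * x ∨ g = y ∨ g = x * y ∨
    g = y * x ∨ g = x * x * y ∨ g = y * x * x ∨ g = x * y * x ∨ g = y * x * y ∨ g = x * x * y * x ∨
    g = x * y * x * x := by decide

/-- `a = 1 + x + y + x⁻¹ y x ∈ 𝔽₂[T]`. [cite: LinPryadko2024, §IV.E Example 11 (arXiv:2306.16400 chunk p0011 L80–81); WangLinPryadko2023, Example 2 (arXiv:2305.06890 chunk p0006 L38–39)] -/
def a : T → ZMod 2 := fun g => if g = 1 ∨ g = x ∨ g = y ∨ g = x⁻¹ * y * x then 1 else 0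

/-- `b = 1 + x + y + y x ∈ 𝔽₂[T]`. [cite: LinPryadko2024, §IV.E Example 11 (arXiv:2306.16400 chunk p0011 L80–81); WangLinPryadko2023, Example 2 (arXiv:2305.06890 chunk p0006 L38–39)] -/
def b : T → ZMod 2 := fun g => if g = 1 ∨ g = x ∨ g = y ∨ g = y * x then 1 else 0

/-- Both generators have weight `4` (four distinct group elements each).
[cite: LinPryadko2024, §IV.E Example 11 (arXiv:2306.16400 chunk p0011 L80–81)] -/
theorem weights : hammingNorm a = 4 ∧ hammingNorm b = 4 := by decide

/-- `b = (1 + y)(1 + x)`: `b` is the indicator of `{1, x, y, yx}`. [cite: LinPryadko2024, §IV.E Example 11 (arXiv:2306.16400 chunk p0011 L80–81)] -/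
theorem b_eq : b = fun g => if g = 1 * 1 ∨ g = 1 * x ∨ g = y * 1 ∨ g = y * x then 1 else 0 := by decide

/-- **The printed code** `LP[a,b]` over `𝔽₂[A₄]`: `24` qubits.
[cite: LinPryadko2024, §IV.E Example 11 (arXiv:2306.16400 chunk p0011 L76–83); §IV.A eq. (10)] -/
abbrev code : CSSCode T T (T ⊕ T) := css a b

/-- `n = 24`. [cite: LinPryadko2024, §IV.E Example 11 "[[24,5,3]]" (arXiv:2306.16400 chunk p0011 L82–83)] -/
theorem card_qubits : Fintype.card (T ⊕ T) = 24 := by decide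

/-! ### The weight-2 `Z`-logical `(0 | 1 + y)` -/

/-- `v = (0 | 1 + y)`: the `Z`-type vector supported on the right-block qubits `1` and `y`.
[cite: LinPryadko2024, §III "c_Z = (u; v)" two-block codewords (arXiv:2306.16400 chunk p0007 L1–6)] -/
def v : T ⊕ T → ZMod 2 := Sum.elim 0 fun g => if g = 1 ∨ g = y then 1 else 0

/-- `|v| = 2`. [cite: LinPryadko2024, §IV.E Example 11 (arXiv:2306.16400 chunk p0011 L76–83)] -/
theorem hammingNorm_v : hammingNorm v = 2 := by decide

/-- `H_X v = 0`, i.e. `(1 + y) · b = (1 + y)²(1 + x) = 0`. [cite: LinPryadko2024, §IV.A eq. (10) (R(b) = right multiplication by b) with Example 11] -/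
theorem v_mem_ker : HX a b *ᵥ v = 0 := by decide

/-- The dual witness `t = (1 + xyx | 1 + yx + xyx)` (an `X`-type vector in `ker H_Z` with odd overlap with `v`).
[cite: BravyiEtAl2024, §6 (a kernel vector with odd overlap certifies "not a stabilizer"; arXiv:2308.07915 chunk p0017 L50–66)] -/
def t : T ⊕ T → ZMod 2 :=
  Sum.elim (fun g => if g = 1 ∨ g = x * y * x then 1 else 0)
    (fun g => if g = 1 ∨ g = y * x ∨ g = x * y * x then 1 else 0)

/-- `H_Z t = 0` and `⟨t, v⟩ = 1`. [cite: BravyiEtAl2024, §6 (a kernel vector with odd overlap certifies "not a stabilizer"; arXiv:2308.07915 chunk p0017 L50–66)] -/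
theorem t_witness : HZ a b *ᵥ t = 0 ∧ t ⬝ᵥ v = 1 := by decide

/-- Hence `v` is not a `Z`-stabilizer. [cite: BravyiEtAl2024, §6 (arXiv:2308.07915 chunk p0017 L50–66)] -/
theorem v_not_mem_rowSpace : v ∉ code.rowSpZ :=
  not_mem_rowSpace_of_witness t t_witness.1 (by rw [t_witness.2]; decide)

/-- `d_Z ≤ 2`. [cite: LinPryadko2024, §IV.E Example 11 (printed d = 3; arXiv:2306.16400 chunk p0011 L82–83)] -/
theorem dZ_le_two : code.dZ ≤ 2 :=
  hammingNorm_v ▸ code.dZ_le_hammingNorm v_mem_ker v_not_mem_rowSpace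

/-- Every column of `H_X` and of `H_Z` is non-zero, so no weight-1 vector lies in either kernel.
[cite: LinPryadko2024, §IV.A eq. (10) (arXiv:2306.16400 chunk p0009 L17–19)] -/
theorem single_not_mem_ker : ∀ q : T ⊕ T, HX a b *ᵥ Pi.single q 1 ≠ 0 ∧ HZ a b *ᵥ Pi.single q 1 ≠ 0 := by
  decide

/-- A vector of weight `≤ 1` over `𝔽₂` is `0` or a `Pi.single q 1`. [folklore] -/
private theorem eq_zero_or_single_of_hammingNorm_le_one {ι : Type*} [Fintype ι] [DecidableEq ι]
    (w : ι → ZMod 2) (hw : hammingNorm w ≤ 1) : w = 0 ∨ ∃ q, w = Pi.single q 1 := by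
  classical
  by_cases h0 : w = 0
  · exact Or.inl h0
  right
  obtain ⟨q, hq⟩ : ∃ q, w q ≠ 0 := by
    by_contra h
    exact h0 (funext fun i => by_contra fun hne => h ⟨i, hne⟩)
  have h01 : ∀ z : ZMod 2, z = 0 ∨ z = 1 := by decide
  refine ⟨q, funext fun i => ?_⟩
  by_cases hi : i = q
  · subst hi
    rcases h01 (w i) with h | h
    · exact absurd h hq
    · simp [h]
  · -- if `w i ≠ 0` for some `i ≠ q`, the weight would be ≥ 2
    rw [Pi.single_eq_of_ne hi]
    by_contra hne
    have h2 : 2 ≤ hammingNorm w := by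
      unfold hammingNorm
      calc 2 = ({q, i} : Finset ι).card := by rw [Finset.card_pair (Ne.symm hi)]
        _ ≤ _ := Finset.card_le_card (by
          intro j hj
          simp only [Finset.mem_insert, Finset.mem_singleton] at hj
          rcases hj with rfl | rfl <;> simpa)
    omega

/-- **`d_Z(LP[a,b]) = 2`.** [cite: LinPryadko2024, §IV.E Example 11 (printed "[[24,5,3]]"; arXiv:2306.16400 chunk p0011 L82–83); WangLinPryadko2023, Example 2 (arXiv:2305.06890 chunk p0006 L40–41)] -/
theorem dZ_eq_two : code.dZ = 2 := by
  refine code.dZ_eq_of_witness v_mem_ker v_not_mem_rowSpace hammingNorm_v fun w hw hw' => ?_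
  by_contra hlt
  rcases eq_zero_or_single_of_hammingNorm_le_one w (by omega) with rfl | ⟨q, rfl⟩
  · exact hw' (Submodule.zero_mem _)
  · exact (single_not_mem_ker q).1 hw

/-! ### The `X` side: `2 ≤ d_X ≤ 3` -/

/-- `w = (1 + x²y + yx | 0)`, an `X`-type vector of weight `3`. [cite: LinPryadko2024, §IV.E Example 11 (arXiv:2306.16400 chunk p0011 L76–83)] -/
def w : T ⊕ T → ZMod 2 := Sum.elim (fun g => if g = 1 ∨ g = x * x * y ∨ g = y * x then 1 else 0) 0

/-- Its dual witness `u = (1 + y + x + xyx + xy + yx² | 0)`. [cite: BravyiEtAl2024, §6 (arXiv:2308.07915 chunk p0017 L50–66)] -/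
def u : T ⊕ T → ZMod 2 :=
  Sum.elim (fun g => if g = 1 ∨ g = y ∨ g = x ∨ g = x * y * x ∨ g = x * y ∨ g = y * x * x then 1 else 0) 0

/-- `|w| = 3`, `H_Z w = 0`, `H_X u = 0`, `⟨u, w⟩ = 1`. [cite: BravyiEtAl2024, §6 (arXiv:2308.07915 chunk p0017 L50–66)] -/
theorem w_witness : hammingNorm w = 3 ∧ HZ a b *ᵥ w = 0 ∧ HX a b *ᵥ u = 0 ∧ u ⬝ᵥ w = 1 := by decide

/-- `d_X ≤ 3`. [cite: LinPryadko2024, §IV.E Example 11 (arXiv:2306.16400 chunk p0011 L82–83)] -/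
theorem dX_le_three : code.dX ≤ 3 :=
  w_witness.1 ▸ code.dX_le_hammingNorm w_witness.2.1
    (not_mem_rowSpace_of_witness u w_witness.2.2.1 (by rw [w_witness.2.2.2]; decide))

/-- `2 ≤ d_X` (no weight-1 `X`-logical: all columns of `H_Z` are non-zero).
[cite: LinPryadko2024, §IV.A eq. (10) (arXiv:2306.16400 chunk p0009 L17–19)] -/
theorem two_le_dX : 2 ≤ code.dX := by
  refine code.le_dX ⟨w, w_witness.2.1, not_mem_rowSpace_of_witness u w_witness.2.2.1
    (by rw [w_witness.2.2.2]; decide)⟩ fun w' hw hw' => ?_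
  by_contra hlt
  rcases eq_zero_or_single_of_hammingNorm_le_one w' (by omega) with rfl | ⟨q, rfl⟩
  · exact hw' (Submodule.zero_mem _)
  · exact (single_not_mem_ker q).2 hw

/-! ### Conclusion: an `[[24, k, 2]]` code, not `[[24, 5, 3]]` -/

/-- `k > 0` (there is an `X`-logical). [cite: LinPryadko2024, §IV.E Example 11 "k = 5" (arXiv:2306.16400 chunk p0011 L82–83)] -/
theorem k_pos : 0 < code.k := by
  rw [pos_iff_ne_zero, Ne, code.k_eq_zero_iff_dX_eq_zero]
  have := two_le_dX
  omega

/-- **`LP[a,b]` over `𝔽₂[A₄]` is a `[[24, k, 2]]` code** (`k = code.k`, printed as `5`).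
[cite: LinPryadko2024, §IV.E Example 11 (arXiv:2306.16400 chunk p0011 L76–83); WangLinPryadko2023, Example 2 (arXiv:2305.06890 chunk p0006 L33–41)] -/
theorem isCode_two : code.IsCode 24 code.k 2 := by
  have h := code.isCode_of_dX_dZ k_pos rfl dZ_eq_two
  have hmin : min code.dX 2 = 2 := min_eq_right two_le_dX
  rw [hmin] at h
  exact card_qubits ▸ h

/-- **Not `[[n, k, d]]` for any `d ≥ 3`** — in particular not the printed `[[24, 5, 3]]`.
[cite: LinPryadko2024, §IV.E Example 11 "[[24,5,3]]₂" (arXiv:2306.16400 chunk p0011 L82–83); WangLinPryadko2023, Example 2 "[[24,5,3]]₂" (arXiv:2305.06890 chunk p0006 L40–41)] -/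
theorem not_isCode_of_three_le {n k d : ℕ} (hd : 3 ≤ d) : ¬ code.IsCode n k d := by
  intro h
  have := h.le_dX_and_le_dZ.2.1
  rw [dZ_eq_two] at this
  omega

/-- The printed parameter triple is not attained. [cite: LinPryadko2024, §IV.E Example 11 (arXiv:2306.16400 chunk p0011 L82–83)] -/
theorem not_isCode_24_5_3 : ¬ code.IsCode 24 5 3 := not_isCode_of_three_le le_rfl

/-! ### Dimension `k = 5` by rank certificates (`rank H_X = 10`, `rank H_Z = 9`)

`rank H = r` is certified by a factorisation `H = M (U H)` through `Fin r` (so `rank H ≤ r`) and a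
pivot selection `S` with `U H S = 1_r` (so `rank H ≥ r`); all three identities are `decide`d. -/

section Dimension

/-- The enumeration `1, x, x², y, xy, yx, x²y, yx², xyx, yxy, x²yx, xyx²` of `T` used by the
certificate tables. [cite: LinPryadko2024, §IV.E Example 11 "|T| = 12" (arXiv:2306.16400 chunk p0011 L78–79)] -/
def code12 (g : T) : Fin 12 :=
  if g = 1 then 0 else if g = x then 1 else if g = x * x then 2 else if g = y then 3
  else if g = x * y then 4 else if g = y * x then 5 else if g = x * x * y then 6
  else if g = y * x * x then 7 else if g = x * y * x then 8 else if g = y * x * y then 9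
  else if g = x * x * y * x then 10 else 11

/-- Row-operation table `U_X` (the ten pivot rows of an elimination matrix for `H_X`). (Rank certificate data, generated by Gaussian elimination over `𝔽₂`; checked below by `decide`.) [cite: LinPryadko2024, §III "k = n − rank H_X − rank H_Z" (arXiv:2306.16400 chunk p0006 L100–118) with Example 11] -/
def UXtab : Fin 10 → Fin 12 → ZMod 2 :=
  ![![0, 0, 1, 1, 1, 1, 0, 1, 0, 0, 0, 0],
    ![0, 1, 1, 1, 1, 0, 0, 1, 0, 1, 0, 0],
    ![0, 0, 1, 0, 0, 0, 1, 1, 0, 1, 0, 0],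
    ![0, 0, 0, 0, 1, 0, 1, 1, 1, 0, 0, 0],
    ![1, 0, 0, 1, 0, 0, 1, 0, 0, 0, 0, 0],
    ![0, 1, 1, 1, 1, 0, 1, 0, 1, 0, 0, 0],
    ![1, 0, 1, 1, 0, 0, 1, 1, 0, 1, 0, 0],
    ![1, 1, 0, 0, 1, 0, 0, 1, 0, 1, 0, 0],
    ![1, 1, 1, 0, 1, 0, 1, 1, 0, 0, 0, 0],
    ![1, 0, 0, 1, 0, 1, 0, 1, 1, 1, 0, 0]]

/-- Factor table `M_X` with `H_X = M_X (U_X H_X)`. (Rank certificate data, generated by Gaussian elimination over `𝔽₂`; checked below by `decide`.) [cite: LinPryadko2024, §III "k = n − rank H_X − rank H_Z" (arXiv:2306.16400 chunk p0006 L100–118) with Example 11] -/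
def MXtab : Fin 12 → Fin 10 → ZMod 2 :=
  ![![1, 0, 1, 1, 0, 0, 0, 0, 0, 1],
    ![1, 1, 0, 0, 0, 1, 0, 0, 1, 1],
    ![0, 1, 1, 0, 0, 0, 1, 1, 0, 0],
    ![1, 0, 0, 1, 0, 0, 1, 0, 0, 1],
    ![0, 0, 0, 1, 1, 1, 0, 0, 1, 0],
    ![0, 1, 0, 0, 1, 1, 0, 0, 0, 1],
    ![0, 0, 1, 0, 1, 0, 1, 0, 0, 0],
    ![0, 0, 1, 0, 0, 0, 0, 1, 1, 0],
    ![0, 0, 0, 0, 0, 1, 1, 1, 0, 0],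
    ![0, 1, 0, 0, 1, 0, 0, 0, 1, 0],
    ![1, 0, 0, 0, 0, 0, 0, 0, 0, 0],
    ![0, 0, 0, 1, 0, 0, 0, 1, 0, 0]]

/-- The ten pivot columns (qubits) of `U_X H_X`, as (block, group element) with `false` = left block. (Rank certificate data, generated by Gaussian elimination over `𝔽₂`; checked below by `decide`.) [cite: LinPryadko2024, §III "k = n − rank H_X − rank H_Z" (arXiv:2306.16400 chunk p0006 L100–118) with Example 11] -/
def pivX : Fin 10 → Bool × T := ![(false, 1), (false, x), (false, x * x), (false, y), (false, x * y), (false, y * x), (false, x * x * y), (false, y * x * x), (false, y * x * y), (true, 1)]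

/-- Row-operation table `U_Z` (the nine pivot rows of an elimination matrix for `H_Z`). (Rank certificate data, generated by Gaussian elimination over `𝔽₂`; checked below by `decide`.) [cite: LinPryadko2024, §III "k = n − rank H_X − rank H_Z" (arXiv:2306.16400 chunk p0006 L100–118) with Example 11] -/
def UZtab : Fin 9 → Fin 12 → ZMod 2 :=
  ![![1, 1, 0, 1, 1, 0, 1, 0, 0, 0, 0, 0],
    ![1, 0, 1, 0, 0, 0, 0, 1, 0, 1, 0, 0],
    ![1, 1, 0, 1, 1, 0, 0, 1, 0, 0, 0, 0],
    ![1, 0, 1, 0, 1, 1, 0, 1, 0, 0, 0, 0],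
    ![1, 0, 0, 1, 0, 0, 0, 0, 0, 1, 0, 0],
    ![0, 0, 1, 0, 0, 0, 1, 0, 0, 0, 0, 0],
    ![1, 0, 0, 1, 0, 0, 0, 0, 0, 0, 0, 0],
    ![1, 1, 0, 1, 1, 0, 0, 0, 0, 0, 0, 0],
    ![0, 0, 0, 0, 0, 1, 0, 0, 0, 1, 0, 0]]

/-- Factor table `M_Z` with `H_Z = M_Z (U_Z H_Z)`. (Rank certificate data, generated by Gaussian elimination over `𝔽₂`; checked below by `decide`.) [cite: LinPryadko2024, §III "k = n − rank H_X − rank H_Z" (arXiv:2306.16400 chunk p0006 L100–118) with Example 11] -/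
def MZtab : Fin 12 → Fin 9 → ZMod 2 :=
  ![![1, 1, 1, 0, 1, 1, 1, 0, 0],
    ![0, 1, 0, 1, 0, 0, 1, 1, 1],
    ![1, 0, 0, 0, 0, 1, 0, 1, 0],
    ![1, 1, 1, 0, 1, 1, 0, 0, 0],
    ![0, 1, 0, 1, 0, 0, 0, 0, 1],
    ![0, 0, 0, 0, 1, 0, 1, 0, 1],
    ![1, 0, 0, 0, 0, 0, 0, 1, 0],
    ![0, 0, 1, 0, 0, 0, 0, 1, 0],
    ![0, 0, 1, 0, 0, 0, 0, 0, 0],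
    ![0, 0, 0, 0, 1, 0, 1, 0, 0],
    ![0, 0, 0, 1, 0, 1, 0, 0, 1],
    ![0, 0, 0, 1, 0, 0, 0, 0, 0]]

/-- The nine pivot columns (qubits) of `U_Z H_Z`, as (block, group element) with `false` = left block. (Rank certificate data, generated by Gaussian elimination over `𝔽₂`; checked below by `decide`.) [cite: LinPryadko2024, §III "k = n − rank H_X − rank H_Z" (arXiv:2306.16400 chunk p0006 L100–118) with Example 11] -/
def pivZ : Fin 9 → Bool × T := ![(false, 1), (false, x), (false, y), (false, x * y), (false, y * x), (true, 1), (true, x), (true, x * x), (true, y * x)]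

/-- `U_X` as a matrix `Fin 10 × T`. [cite: LinPryadko2024, §III (arXiv:2306.16400 chunk p0006 L100–118)] -/
def UX : Matrix (Fin 10) T (ZMod 2) := fun i g => UXtab i (code12 g)
/-- `M_X` as a matrix `T × Fin 10`. [cite: LinPryadko2024, §III (arXiv:2306.16400 chunk p0006 L100–118)] -/
def MX : Matrix T (Fin 10) (ZMod 2) := fun g j => MXtab (code12 g) j
/-- Pivot-column selector `S_X`. [cite: LinPryadko2024, §III (arXiv:2306.16400 chunk p0006 L100–118)] -/
def SX : Matrix (T ⊕ T) (Fin 10) (ZMod 2) := fun q j =>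
  Sum.elim (fun g => if (pivX j).1 = false ∧ g = (pivX j).2 then 1 else 0)
    (fun g => if (pivX j).1 = true ∧ g = (pivX j).2 then 1 else 0) q
/-- `U_Z`. [cite: LinPryadko2024, §III (arXiv:2306.16400 chunk p0006 L100–118)] -/
def UZ : Matrix (Fin 9) T (ZMod 2) := fun i g => UZtab i (code12 g)
/-- `M_Z`. [cite: LinPryadko2024, §III (arXiv:2306.16400 chunk p0006 L100–118)] -/
def MZ : Matrix T (Fin 9) (ZMod 2) := fun g j => MZtab (code12 g) j
/-- Pivot-column selector `S_Z`. [cite: LinPryadko2024, §III (arXiv:2306.16400 chunk p0006 L100–118)] -/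
def SZ : Matrix (T ⊕ T) (Fin 9) (ZMod 2) := fun q j =>
  Sum.elim (fun g => if (pivZ j).1 = false ∧ g = (pivZ j).2 then 1 else 0)
    (fun g => if (pivZ j).1 = true ∧ g = (pivZ j).2 then 1 else 0) q

/-- Reduced-row table `NXLtab` (`U H` restricted to one block; generated, checked below by `decide`). [cite: LinPryadko2024, §III (arXiv:2306.16400 chunk p0006 L100–118) with Example 11] -/
def NXLtab : Fin 10 → Fin 12 → ZMod 2 :=
  ![![1, 0, 0, 0, 0, 0, 0, 0, 1, 0, 1, 1],
    ![0, 1, 0, 0, 0, 0, 0, 0, 1, 0, 0, 0],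
    ![0, 0, 1, 0, 0, 0, 0, 0, 0, 0, 0, 1],
    ![0, 0, 0, 1, 0, 0, 0, 0, 1, 0, 0, 0],
    ![0, 0, 0, 0, 1, 0, 0, 0, 1, 0, 1, 1],
    ![0, 0, 0, 0, 0, 1, 0, 0, 0, 0, 0, 1],
    ![0, 0, 0, 0, 0, 0, 1, 0, 0, 0, 1, 0],
    ![0, 0, 0, 0, 0, 0, 0, 1, 1, 0, 1, 1],
    ![0, 0, 0, 0, 0, 0, 0, 0, 0, 1, 1, 0],
    ![0, 0, 0, 0, 0, 0, 0, 0, 0, 0, 0, 0]]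

/-- Reduced-row table `NXRtab` (`U H` restricted to one block; generated, checked below by `decide`). [cite: LinPryadko2024, §III (arXiv:2306.16400 chunk p0006 L100–118) with Example 11] -/
def NXRtab : Fin 10 → Fin 12 → ZMod 2 :=
  ![![0, 0, 1, 0, 0, 0, 1, 0, 0, 0, 1, 1],
    ![0, 1, 1, 0, 1, 0, 1, 0, 0, 0, 0, 0],
    ![0, 1, 0, 0, 1, 1, 0, 1, 1, 1, 1, 1],
    ![0, 0, 1, 0, 0, 0, 1, 0, 0, 0, 1, 1],
    ![0, 0, 0, 0, 0, 1, 0, 1, 1, 1, 0, 0],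
    ![0, 0, 0, 0, 0, 1, 0, 0, 0, 1, 1, 1],
    ![0, 1, 1, 0, 1, 1, 1, 0, 0, 1, 1, 1],
    ![0, 0, 1, 0, 0, 0, 1, 1, 1, 0, 0, 0],
    ![0, 1, 1, 0, 1, 0, 1, 1, 1, 0, 1, 1],
    ![1, 1, 1, 1, 1, 1, 1, 1, 1, 1, 1, 1]]

/-- Reduced-row table `NZLtab` (`U H` restricted to one block; generated, checked below by `decide`). [cite: LinPryadko2024, §III (arXiv:2306.16400 chunk p0006 L100–118) with Example 11] -/
def NZLtab : Fin 9 → Fin 12 → ZMod 2 :=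
  ![![1, 0, 1, 0, 0, 0, 1, 0, 0, 0, 1, 0],
    ![0, 1, 1, 0, 0, 0, 0, 0, 1, 1, 1, 1],
    ![0, 0, 0, 1, 0, 0, 0, 1, 1, 0, 0, 1],
    ![0, 0, 0, 0, 1, 0, 0, 0, 0, 1, 1, 1],
    ![0, 0, 0, 0, 0, 1, 1, 1, 0, 1, 0, 0],
    ![0, 0, 0, 0, 0, 0, 0, 0, 0, 0, 0, 0],
    ![0, 0, 0, 0, 0, 0, 0, 0, 0, 0, 0, 0],
    ![0, 0, 0, 0, 0, 0, 0, 0, 0, 0, 0, 0],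
    ![0, 0, 0, 0, 0, 0, 0, 0, 0, 0, 0, 0]]

/-- Reduced-row table `NZRtab` (`U H` restricted to one block; generated, checked below by `decide`). [cite: LinPryadko2024, §III (arXiv:2306.16400 chunk p0006 L100–118) with Example 11] -/
def NZRtab : Fin 9 → Fin 12 → ZMod 2 :=
  ![![0, 0, 0, 1, 0, 0, 0, 0, 1, 0, 1, 1],
    ![0, 0, 0, 1, 1, 0, 1, 1, 1, 1, 1, 1],
    ![0, 0, 0, 0, 0, 0, 1, 1, 1, 0, 1, 0],
    ![0, 0, 0, 1, 0, 0, 0, 0, 0, 1, 1, 1],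
    ![0, 0, 0, 0, 0, 0, 0, 1, 0, 1, 1, 1],
    ![1, 0, 0, 1, 0, 0, 0, 1, 1, 0, 0, 0],
    ![0, 1, 0, 0, 1, 0, 0, 0, 0, 0, 1, 1],
    ![0, 0, 1, 0, 0, 0, 1, 0, 0, 0, 1, 1],
    ![0, 0, 0, 0, 0, 1, 0, 1, 1, 1, 0, 0]]

/-- `N_X = U_X H_X` (the ten non-zero reduced rows). [cite: LinPryadko2024, §III (arXiv:2306.16400 chunk p0006 L100–118)] -/
def NX : Matrix (Fin 10) (T ⊕ T) (ZMod 2) := fun i q => Sum.elim (fun g => NXLtab i (code12 g)) (fun g => NXRtab i (code12 g)) q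
/-- `N_Z = U_Z H_Z` (the nine non-zero reduced rows). [cite: LinPryadko2024, §III (arXiv:2306.16400 chunk p0006 L100–118)] -/
def NZ : Matrix (Fin 9) (T ⊕ T) (ZMod 2) := fun i q => Sum.elim (fun g => NZLtab i (code12 g)) (fun g => NZRtab i (code12 g)) q

/-- The `H_X` certificate identities: `U_X H_X = N_X`, `H_X = M_X N_X`, `N_X S_X = 1`.
[cite: LinPryadko2024, §III (arXiv:2306.16400 chunk p0006 L100–118) with Example 11] -/
theorem HX_cert : UX * HX a b = NX ∧ MX * NX = HX a b ∧ NX * SX = 1 := by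
  refine ⟨?_, ?_, ?_⟩ <;> decide +kernel

/-- The `H_Z` certificate identities. [cite: LinPryadko2024, §III (arXiv:2306.16400 chunk p0006 L100–118) with Example 11] -/
theorem HZ_cert : UZ * HZ a b = NZ ∧ MZ * NZ = HZ a b ∧ NZ * SZ = 1 := by
  refine ⟨?_, ?_, ?_⟩ <;> decide +kernel

/-- **`rank H_X = 10`.** [cite: LinPryadko2024, §IV.E Example 11 (arXiv:2306.16400 chunk p0011 L76–83)] -/
theorem rank_HX : (HX a b).rank = 10 := by
  obtain ⟨h1, h2, h3⟩ := HX_cert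
  apply le_antisymm
  · calc (HX a b).rank = (MX * NX).rank := by rw [h2]
      _ ≤ NX.rank := Matrix.rank_mul_le_right _ _
      _ ≤ Fintype.card (Fin 10) := Matrix.rank_le_card_height _
      _ = 10 := Fintype.card_fin 10
  · calc 10 = (1 : Matrix (Fin 10) (Fin 10) (ZMod 2)).rank := by rw [Matrix.rank_one, Fintype.card_fin]
      _ = (NX * SX).rank := by rw [h3]
      _ ≤ NX.rank := Matrix.rank_mul_le_left _ _
      _ = (UX * HX a b).rank := by rw [h1]
      _ ≤ (HX a b).rank := Matrix.rank_mul_le_right _ _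

/-- **`rank H_Z = 9`** (`≠ rank H_X`: the "essentially non-abelian" feature `δ_X ≠ δ_Z` of the example).
[cite: LinPryadko2024, §IV.E Example 11 and the preceding paragraph "δ_X ≠ δ_Z" (arXiv:2306.16400 chunk p0011 L70–83)] -/
theorem rank_HZ : (HZ a b).rank = 9 := by
  obtain ⟨h1, h2, h3⟩ := HZ_cert
  apply le_antisymm
  · calc (HZ a b).rank = (MZ * NZ).rank := by rw [h2]
      _ ≤ NZ.rank := Matrix.rank_mul_le_right _ _
      _ ≤ Fintype.card (Fin 9) := Matrix.rank_le_card_height _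
      _ = 9 := Fintype.card_fin 9
  · calc 9 = (1 : Matrix (Fin 9) (Fin 9) (ZMod 2)).rank := by rw [Matrix.rank_one, Fintype.card_fin]
      _ = (NZ * SZ).rank := by rw [h3]
      _ ≤ NZ.rank := Matrix.rank_mul_le_left _ _
      _ = (UZ * HZ a b).rank := by rw [h1]
      _ ≤ (HZ a b).rank := Matrix.rank_mul_le_right _ _

/-- **`k = 5`** (`= 24 − 10 − 9`), as printed. [cite: LinPryadko2024, §IV.E Example 11 "[[24,5,3]]" (arXiv:2306.16400 chunk p0011 L82–83); WangLinPryadko2023, Example 2] -/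
theorem k_eq_five : code.k = 5 := by
  rw [CSSCode.k_eq, card_qubits]
  change 24 - (HX a b).rank - (HZ a b).rank = 5
  rw [rank_HX, rank_HZ]

/-- **The printed code is a `[[24, 5, 2]]` code** (not `[[24, 5, 3]]`).
[cite: LinPryadko2024, §IV.E Example 11 (arXiv:2306.16400 chunk p0011 L76–83); WangLinPryadko2023, Example 2 (arXiv:2305.06890 chunk p0006 L33–41)] -/
theorem isCode_24_5_2 : code.IsCode 24 5 2 := k_eq_five ▸ isCode_two

end Dimension

/-! ### The example in the corrected dimension theory: `(k_S, δ_X, δ_Z) = (2, 0, 1)`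

With `TwoBlockCodeDimension.lean` (`k = 2k_S + δ_X + δ_Z` for any commuting pair, the defects being
the intrinsic `δ_X = dim(col A ∩ col B) − rank AB`, `δ_Z = dim(row A ∩ row B) − rank AB`): the ranks
`rank A = 9`, `rank B = 5`, `rank AB = 4` (certified as above) give `k_S = 12 + 4 − 9 − 5 = 2`, and
`rank H_X + k_S + δ_X = 12 = rank H_Z + k_S + δ_Z` give `δ_X = 0`, `δ_Z = 1` — so the example DOES
exhibit `δ_X ≠ δ_Z` (the feature it was printed for), with `k = 2·2 + 0 + 1 = 5`. -/

section Defects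

/-- Rank-certificate table `UAtab` for the single blocks `A = L(a)`, `B = R(b)`, `AB` (generated by Gaussian elimination over `𝔽₂`; checked below by `decide`). [cite: LinPryadko2024, §III.A "k_S = ℓ + rank AB − rank A − rank B", rank defects δ_X, δ_Z (arXiv:2306.16400 chunk p0006 L14–40, L100–118) with Example 11] -/
def UAtab : Fin 9 → Fin 12 → ZMod 2 :=
  ![![0, 0, 1, 1, 1, 1, 0, 1, 0, 0, 0, 0],
    ![1, 1, 1, 0, 1, 1, 0, 0, 1, 0, 0, 0],
    ![1, 0, 1, 1, 0, 1, 1, 0, 1, 0, 0, 0],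
    ![0, 0, 0, 0, 1, 0, 1, 1, 1, 0, 0, 0],
    ![1, 0, 0, 1, 0, 0, 1, 0, 0, 0, 0, 0],
    ![0, 1, 1, 1, 1, 0, 1, 0, 1, 0, 0, 0],
    ![0, 0, 1, 0, 0, 1, 1, 0, 1, 0, 0, 0],
    ![0, 1, 0, 1, 1, 1, 0, 0, 1, 0, 0, 0],
    ![1, 1, 1, 0, 1, 0, 1, 1, 0, 0, 0, 0]]

/-- Rank-certificate table `MAtab` for the single blocks `A = L(a)`, `B = R(b)`, `AB` (generated by Gaussian elimination over `𝔽₂`; checked below by `decide`). [cite: LinPryadko2024, §III.A "k_S = ℓ + rank AB − rank A − rank B", rank defects δ_X, δ_Z (arXiv:2306.16400 chunk p0006 L14–40, L100–118) with Example 11] -/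
def MAtab : Fin 12 → Fin 9 → ZMod 2 :=
  ![![1, 0, 1, 1, 0, 0, 0, 0, 0],
    ![1, 1, 0, 0, 0, 1, 0, 0, 1],
    ![0, 1, 1, 0, 0, 0, 1, 1, 0],
    ![1, 0, 0, 1, 0, 0, 1, 0, 0],
    ![0, 0, 0, 1, 1, 1, 0, 0, 1],
    ![0, 1, 0, 0, 1, 1, 0, 0, 0],
    ![0, 0, 1, 0, 1, 0, 1, 0, 0],
    ![0, 0, 1, 0, 0, 0, 0, 1, 1],
    ![0, 0, 0, 0, 0, 1, 1, 1, 0],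
    ![0, 1, 0, 0, 1, 0, 0, 0, 1],
    ![1, 0, 0, 0, 0, 0, 0, 0, 0],
    ![0, 0, 0, 1, 0, 0, 0, 1, 0]]

/-- Rank-certificate table `NAtab` for the single blocks `A = L(a)`, `B = R(b)`, `AB` (generated by Gaussian elimination over `𝔽₂`; checked below by `decide`). [cite: LinPryadko2024, §III.A "k_S = ℓ + rank AB − rank A − rank B", rank defects δ_X, δ_Z (arXiv:2306.16400 chunk p0006 L14–40, L100–118) with Example 11] -/
def NAtab : Fin 9 → Fin 12 → ZMod 2 :=
  ![![1, 0, 0, 0, 0, 0, 0, 0, 1, 0, 1, 1],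
    ![0, 1, 0, 0, 0, 0, 0, 0, 1, 0, 0, 0],
    ![0, 0, 1, 0, 0, 0, 0, 0, 0, 0, 0, 1],
    ![0, 0, 0, 1, 0, 0, 0, 0, 1, 0, 0, 0],
    ![0, 0, 0, 0, 1, 0, 0, 0, 1, 0, 1, 1],
    ![0, 0, 0, 0, 0, 1, 0, 0, 0, 0, 0, 1],
    ![0, 0, 0, 0, 0, 0, 1, 0, 0, 0, 1, 0],
    ![0, 0, 0, 0, 0, 0, 0, 1, 1, 0, 1, 1],
    ![0, 0, 0, 0, 0, 0, 0, 0, 0, 1, 1, 0]]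

/-- Rank-certificate table `pivA` for the single blocks `A = L(a)`, `B = R(b)`, `AB` (generated by Gaussian elimination over `𝔽₂`; checked below by `decide`). [cite: LinPryadko2024, §III.A "k_S = ℓ + rank AB − rank A − rank B", rank defects δ_X, δ_Z (arXiv:2306.16400 chunk p0006 L14–40, L100–118) with Example 11] -/
def pivA : Fin 9 → T := ![1, x, x * x, y, x * y, y * x, x * x * y, y * x * x, y * x * y]

/-- Rank-certificate table `UBtab` for the single blocks `A = L(a)`, `B = R(b)`, `AB` (generated by Gaussian elimination over `𝔽₂`; checked below by `decide`). [cite: LinPryadko2024, §III.A "k_S = ℓ + rank AB − rank A − rank B", rank defects δ_X, δ_Z (arXiv:2306.16400 chunk p0006 L14–40, L100–118) with Example 11] -/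
def UBtab : Fin 5 → Fin 12 → ZMod 2 :=
  ![![0, 1, 0, 0, 1, 0, 0, 0, 0, 0, 0, 0],
    ![0, 0, 0, 0, 1, 0, 0, 0, 0, 0, 0, 0],
    ![1, 1, 0, 0, 1, 0, 0, 0, 0, 0, 0, 0],
    ![0, 1, 0, 0, 1, 1, 0, 0, 0, 0, 0, 0],
    ![0, 1, 0, 1, 1, 0, 0, 0, 0, 0, 0, 0]]

/-- Rank-certificate table `MBtab` for the single blocks `A = L(a)`, `B = R(b)`, `AB` (generated by Gaussian elimination over `𝔽₂`; checked below by `decide`). [cite: LinPryadko2024, §III.A "k_S = ℓ + rank AB − rank A − rank B", rank defects δ_X, δ_Z (arXiv:2306.16400 chunk p0006 L14–40, L100–118) with Example 11] -/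
def MBtab : Fin 12 → Fin 5 → ZMod 2 :=
  ![![1, 0, 1, 0, 0],
    ![1, 1, 0, 0, 0],
    ![0, 1, 1, 0, 0],
    ![1, 0, 0, 0, 1],
    ![0, 1, 0, 0, 0],
    ![1, 0, 0, 1, 0],
    ![0, 0, 1, 1, 0],
    ![0, 0, 0, 1, 1],
    ![0, 1, 0, 0, 1],
    ![0, 0, 0, 1, 0],
    ![0, 0, 1, 0, 0],
    ![0, 0, 0, 0, 1]]

/-- Rank-certificate table `NBtab` for the single blocks `A = L(a)`, `B = R(b)`, `AB` (generated by Gaussian elimination over `𝔽₂`; checked below by `decide`). [cite: LinPryadko2024, §III.A "k_S = ℓ + rank AB − rank A − rank B", rank defects δ_X, δ_Z (arXiv:2306.16400 chunk p0006 L14–40, L100–118) with Example 11] -/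
def NBtab : Fin 5 → Fin 12 → ZMod 2 :=
  ![![1, 0, 0, 1, 0, 0, 0, 0, 0, 0, 1, 1],
    ![0, 1, 0, 0, 1, 0, 0, 0, 0, 0, 1, 1],
    ![0, 0, 1, 0, 0, 0, 1, 0, 0, 0, 1, 1],
    ![0, 0, 0, 0, 0, 1, 0, 0, 0, 1, 1, 1],
    ![0, 0, 0, 0, 0, 0, 0, 1, 1, 0, 1, 1]]

/-- Rank-certificate table `pivB` for the single blocks `A = L(a)`, `B = R(b)`, `AB` (generated by Gaussian elimination over `𝔽₂`; checked below by `decide`). [cite: LinPryadko2024, §III.A "k_S = ℓ + rank AB − rank A − rank B", rank defects δ_X, δ_Z (arXiv:2306.16400 chunk p0006 L14–40, L100–118) with Example 11] -/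
def pivB : Fin 5 → T := ![1, x, x * x, y * x, y * x * x]

/-- Rank-certificate table `UABtab` for the single blocks `A = L(a)`, `B = R(b)`, `AB` (generated by Gaussian elimination over `𝔽₂`; checked below by `decide`). [cite: LinPryadko2024, §III.A "k_S = ℓ + rank AB − rank A − rank B", rank defects δ_X, δ_Z (arXiv:2306.16400 chunk p0006 L14–40, L100–118) with Example 11] -/
def UABtab : Fin 4 → Fin 12 → ZMod 2 :=
  ![![1, 1, 0, 0, 0, 0, 0, 0, 0, 0, 0, 0],
    ![0, 0, 0, 0, 1, 0, 0, 0, 0, 0, 0, 0],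
    ![1, 0, 0, 0, 1, 0, 0, 0, 0, 0, 0, 0],
    ![0, 0, 0, 1, 0, 0, 0, 0, 0, 0, 0, 0]]

/-- Rank-certificate table `MABtab` for the single blocks `A = L(a)`, `B = R(b)`, `AB` (generated by Gaussian elimination over `𝔽₂`; checked below by `decide`). [cite: LinPryadko2024, §III.A "k_S = ℓ + rank AB − rank A − rank B", rank defects δ_X, δ_Z (arXiv:2306.16400 chunk p0006 L14–40, L100–118) with Example 11] -/
def MABtab : Fin 12 → Fin 4 → ZMod 2 :=
  ![![0, 1, 1, 0],
    ![1, 1, 1, 0],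
    ![1, 0, 0, 0],
    ![0, 0, 0, 1],
    ![0, 1, 0, 0],
    ![0, 0, 1, 1],
    ![0, 1, 0, 1],
    ![0, 0, 1, 0],
    ![1, 1, 1, 1],
    ![1, 0, 0, 1],
    ![1, 1, 0, 0],
    ![1, 0, 1, 1]]

/-- Rank-certificate table `NABtab` for the single blocks `A = L(a)`, `B = R(b)`, `AB` (generated by Gaussian elimination over `𝔽₂`; checked below by `decide`). [cite: LinPryadko2024, §III.A "k_S = ℓ + rank AB − rank A − rank B", rank defects δ_X, δ_Z (arXiv:2306.16400 chunk p0006 L14–40, L100–118) with Example 11] -/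
def NABtab : Fin 4 → Fin 12 → ZMod 2 :=
  ![![1, 0, 0, 1, 0, 0, 0, 1, 1, 0, 0, 0],
    ![0, 1, 0, 0, 1, 0, 0, 1, 1, 0, 0, 0],
    ![0, 0, 1, 0, 0, 0, 1, 0, 0, 0, 1, 1],
    ![0, 0, 0, 0, 0, 1, 0, 0, 0, 1, 1, 1]]

/-- Rank-certificate table `pivAB` for the single blocks `A = L(a)`, `B = R(b)`, `AB` (generated by Gaussian elimination over `𝔽₂`; checked below by `decide`). [cite: LinPryadko2024, §III.A "k_S = ℓ + rank AB − rank A − rank B", rank defects δ_X, δ_Z (arXiv:2306.16400 chunk p0006 L14–40, L100–118) with Example 11] -/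
def pivAB : Fin 4 → T := ![1, x, x * x, y * x]

/-- `U_A` as a matrix. [cite: LinPryadko2024, §III.A (arXiv:2306.16400 chunk p0006 L14–40)] -/
def UA : Matrix (Fin 9) T (ZMod 2) := fun i g => UAtab i (code12 g)
/-- `M_A` as a matrix. [cite: LinPryadko2024, §III.A (arXiv:2306.16400 chunk p0006 L14–40)] -/
def MA : Matrix T (Fin 9) (ZMod 2) := fun g j => MAtab (code12 g) j
/-- `N_A` as a matrix. [cite: LinPryadko2024, §III.A (arXiv:2306.16400 chunk p0006 L14–40)] -/
def NA : Matrix (Fin 9) T (ZMod 2) := fun i g => NAtab i (code12 g)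
/-- `S_A`, the pivot selector. [cite: LinPryadko2024, §III.A (arXiv:2306.16400 chunk p0006 L14–40)] -/
def SA : Matrix T (Fin 9) (ZMod 2) := fun g j => if g = pivA j then 1 else 0
/-- `U_B` as a matrix. [cite: LinPryadko2024, §III.A (arXiv:2306.16400 chunk p0006 L14–40)] -/
def UB : Matrix (Fin 5) T (ZMod 2) := fun i g => UBtab i (code12 g)
/-- `M_B` as a matrix. [cite: LinPryadko2024, §III.A (arXiv:2306.16400 chunk p0006 L14–40)] -/
def MB : Matrix T (Fin 5) (ZMod 2) := fun g j => MBtab (code12 g) j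
/-- `N_B` as a matrix. [cite: LinPryadko2024, §III.A (arXiv:2306.16400 chunk p0006 L14–40)] -/
def NB : Matrix (Fin 5) T (ZMod 2) := fun i g => NBtab i (code12 g)
/-- `S_B`, the pivot selector. [cite: LinPryadko2024, §III.A (arXiv:2306.16400 chunk p0006 L14–40)] -/
def SB : Matrix T (Fin 5) (ZMod 2) := fun g j => if g = pivB j then 1 else 0
/-- `U_{AB}` as a matrix. [cite: LinPryadko2024, §III.A (arXiv:2306.16400 chunk p0006 L14–40)] -/
def UAB : Matrix (Fin 4) T (ZMod 2) := fun i g => UABtab i (code12 g)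
/-- `M_{AB}` as a matrix. [cite: LinPryadko2024, §III.A (arXiv:2306.16400 chunk p0006 L14–40)] -/
def MAB : Matrix T (Fin 4) (ZMod 2) := fun g j => MABtab (code12 g) j
/-- `N_{AB}` as a matrix. [cite: LinPryadko2024, §III.A (arXiv:2306.16400 chunk p0006 L14–40)] -/
def NAB : Matrix (Fin 4) T (ZMod 2) := fun i g => NABtab i (code12 g)
/-- `S_{AB}`, the pivot selector. [cite: LinPryadko2024, §III.A (arXiv:2306.16400 chunk p0006 L14–40)] -/
def SAB : Matrix T (Fin 4) (ZMod 2) := fun g j => if g = pivAB j then 1 else 0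

/-- Certificate identities for `A = L(a)`. [cite: LinPryadko2024, §III.A (arXiv:2306.16400 chunk p0006 L14–40) with Example 11] -/
theorem A_cert : UA * leftMul a = NA ∧ MA * NA = leftMul a ∧ NA * SA = 1 := by
  refine ⟨?_, ?_, ?_⟩ <;> decide +kernel

/-- Certificate identities for `B = R(b)`. [cite: LinPryadko2024, §III.A (arXiv:2306.16400 chunk p0006 L14–40) with Example 11] -/
theorem B_cert : UB * rightMul b = NB ∧ MB * NB = rightMul b ∧ NB * SB = 1 := by
  refine ⟨?_, ?_, ?_⟩ <;> decide +kernel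

/-- Certificate identities for `AB = L(a) R(b)`. [cite: LinPryadko2024, §III.A (arXiv:2306.16400 chunk p0006 L14–40) with Example 11] -/
theorem AB_cert : UAB * (leftMul a * rightMul b) = NAB ∧ MAB * NAB = leftMul a * rightMul b ∧
    NAB * SAB = 1 := by
  refine ⟨?_, ?_, ?_⟩ <;> decide +kernel

/-- The rank-from-certificate argument, once: `U H = N`, `M N = H`, `N S = 1_r ⟹ rank H = r`. [folklore] -/
private theorem rank_eq_of_cert {m n : Type*} [Fintype m] [Fintype n] [DecidableEq n] {r : ℕ}
    {H : Matrix m n (ZMod 2)} {U : Matrix (Fin r) m (ZMod 2)} {M : Matrix m (Fin r) (ZMod 2)}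
    {N : Matrix (Fin r) n (ZMod 2)} {S : Matrix n (Fin r) (ZMod 2)}
    (h1 : U * H = N) (h2 : M * N = H) (h3 : N * S = 1) : H.rank = r := by
  apply le_antisymm
  · calc H.rank = (M * N).rank := by rw [h2]
      _ ≤ N.rank := Matrix.rank_mul_le_right _ _
      _ ≤ Fintype.card (Fin r) := Matrix.rank_le_card_height _
      _ = r := Fintype.card_fin r
  · calc r = (1 : Matrix (Fin r) (Fin r) (ZMod 2)).rank := by rw [Matrix.rank_one, Fintype.card_fin]
      _ = (N * S).rank := by rw [h3]
      _ ≤ N.rank := Matrix.rank_mul_le_left _ _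
      _ = (U * H).rank := by rw [h1]
      _ ≤ H.rank := Matrix.rank_mul_le_right _ _

/-- `rank L(a) = 9`, `rank R(b) = 5`, `rank L(a)R(b) = 4`. [cite: LinPryadko2024, §III.A (arXiv:2306.16400 chunk p0006 L14–40) with Example 11] -/
theorem block_ranks :
    (leftMul a).rank = 9 ∧ (rightMul b).rank = 5 ∧ (leftMul a * rightMul b).rank = 4 :=
  ⟨rank_eq_of_cert A_cert.1 A_cert.2.1 A_cert.2.2, rank_eq_of_cert B_cert.1 B_cert.2.1 B_cert.2.2,
    rank_eq_of_cert AB_cert.1 AB_cert.2.1 AB_cert.2.2⟩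

/-- **`k_S = 2`** (`= 12 + rank AB − rank A − rank B`). [cite: LinPryadko2024, §III.A "k_S = ℓ + rank AB − rank A − rank B" (arXiv:2306.16400 chunk p0006 L30–40) with Example 11] -/
theorem kS_eq_two : TwoBlock.kS (leftMul a) (rightMul b) = 2 := by
  obtain ⟨hA, hB, hAB⟩ := block_ranks
  unfold TwoBlock.kS
  rw [hA, hB, hAB, generates.1]

/-- **`δ_X = 0` and `δ_Z = 1`** (the intrinsic rank defects of `TwoBlockCodeDimension.lean`): the
example has `δ_X ≠ δ_Z`, as LP24 §IV.E says of it, and `k = 2k_S + δ_X + δ_Z = 5`.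
[cite: LinPryadko2024, §IV.E "there exist essentially non-abelian 2BGA codes where δ_X ≠ δ_Z or δ_X = δ_Z ≠ 0" with Example 11 (arXiv:2306.16400 chunk p0011 L70–83)] -/
theorem defects :
    TwoBlock.defectX (leftMul a) (rightMul b) = 0 ∧ TwoBlock.defectZ (leftMul a) (rightMul b) = 1 := by
  have hc : leftMul a * rightMul b = rightMul b * leftMul a := leftMul_mul_rightMul_comm a b
  have h1 := TwoBlock.rank_HX_add_kS_add_defectX (F := ZMod 2) hc
  have h2 := TwoBlock.rank_HZ_add_kS_add_defectZ (F := ZMod 2) hc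
  rw [TwoBlock.HX_leftMul_rightMul, rank_HX, kS_eq_two, generates.1] at h1
  rw [TwoBlock.HZ_leftMul_rightMul, rank_HZ, kS_eq_two, generates.1] at h2
  omega

end Defects

/-! ### `d_X = 3` exactly: the printed `d = 3` is the `X`-distance (appended 2026-08-27, qec-lit-3 g6)

The columns of `H_Z` are nonzero and PAIRWISE DISTINCT, so no `X`-logical has weight `≤ 2`; with the weight-3
`X`-logical `w` this pins `d_X = 3`, while `d_Z = 2` (`dZ_eq_two`). Hence the printed `[[24,5,3]]` reports the
`X`-distance; the code distance `min(d_X, d_Z)` is `2` (for a non-abelian group the two sectors of `LP[a,b]` need not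
have equal distance — cf. `GroupAlgebraCodeTransposeDistance.lean`). -/

section XDistance

set_option maxRecDepth 200000 in
/-- The columns of `H_Z` are pairwise distinct. [folklore] -/
private theorem HZ_col_injective :
    ∀ q q' : T ⊕ T, (fun i => HZ a b i q) = (fun i => HZ a b i q') → q = q' := by
  decide

/-- Over `𝔽₂`: nonzero + pairwise-distinct columns ⇒ every nonzero kernel vector has weight `≥ 3`. [folklore] -/
private theorem three_le_hammingNorm_of_mulVec_eq_zero {ρ ι : Type*} [Fintype ι] [DecidableEq ι]
    (M : Matrix ρ ι (ZMod 2)) (hcol : ∀ q, M *ᵥ Pi.single q 1 ≠ 0)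
    (hinj : ∀ q q', (fun i => M i q) = (fun i => M i q') → q = q') {w : ι → ZMod 2} (hw : M *ᵥ w = 0)
    (hw0 : w ≠ 0) : 3 ≤ hammingNorm w := by
  by_contra hlt
  push Not at hlt
  -- the support `S` of `w` has `1 ≤ |S| ≤ 2`
  set S : Finset ι := Finset.univ.filter (fun j => w j ≠ 0) with hS
  have hcard : S.card = hammingNorm w := by simp [hS, hammingNorm]
  have hpos : 0 < hammingNorm w := hammingNorm_pos_iff.mpr hw0
  have h01 : ∀ z : ZMod 2, z ≠ 0 → z = 1 := by decide
  have hwS : ∀ j, w j = if j ∈ S then 1 else 0 := fun j => by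
    by_cases hj : j ∈ S
    · rw [if_pos hj]; exact h01 _ (by simpa [hS] using hj)
    · rw [if_neg hj]; simpa [hS] using hj
  have hsum : ∀ i, (M *ᵥ w) i = ∑ j ∈ S, M i j := fun i => by
    simp only [mulVec, dotProduct, hwS, mul_ite, mul_one, mul_zero, Finset.sum_ite_mem, Finset.univ_inter]
  rcases Nat.lt_or_ge S.card 2 with h1 | h2
  · have hS1 : S.card = 1 := by omega
    obtain ⟨q, hq⟩ := Finset.card_eq_one.mp hS1
    refine hcol q ?_
    have hwq : w = Pi.single q 1 := funext fun j => by
      rw [hwS j, hq]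
      by_cases hj : j = q
      · subst hj; simp
      · simp [hj]
    rw [← hwq, hw]
  · have hS2 : S.card = 2 := by omega
    obtain ⟨q, q', hqq, hqS⟩ := Finset.card_eq_two.mp hS2
    refine hqq (hinj q q' (funext fun i => ?_))
    have := congrFun hw i
    rw [hsum i, hqS, Finset.sum_pair hqq] at this
    have key : ∀ x y : ZMod 2, x + y = 0 → x = y := by decide
    exact key _ _ this

/-- **`d_X(LP[a,b]) = 3`** — the printed distance is the `X`-distance. [cite: LinPryadko2024, §IV.E Example 11 "[[24,5,3]]" (arXiv:2306.16400 chunk p0011 L82–83); WangLinPryadko2023, Example 2 (arXiv:2305.06890 chunk p0006 L40–41)] -/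
theorem dX_eq_three : code.dX = 3 := by
  refine le_antisymm dX_le_three (code.le_dX ⟨w, w_witness.2.1, not_mem_rowSpace_of_witness u w_witness.2.2.1
    (by rw [w_witness.2.2.2]; decide)⟩ fun w' hw hw' => ?_)
  exact three_le_hammingNorm_of_mulVec_eq_zero _ (fun q => (single_not_mem_ker q).2) HZ_col_injective hw
    fun h => hw' (h ▸ Submodule.zero_mem _)

/-- ★ **Summary: `(d_X, d_Z) = (3, 2)` for LP24 Example 11** — the two sectors of this non-abelian code have different
distances; `[[24, 5, 3]]` as printed is `[[24, 5, d_X]]`, the code is `[[24, 5, 2]]` (`isCode_24_5_2`).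
[cite: LinPryadko2024, §IV.E Example 11 (arXiv:2306.16400 chunk p0011 L76–83); WangLinPryadko2023, Example 2 (arXiv:2305.06890 chunk p0006 L40–41)] -/
theorem dX_dZ : code.dX = 3 ∧ code.dZ = 2 := ⟨dX_eq_three, dZ_eq_two⟩

end XDistance

end ExampleA4

end TwoBlockGA

end Literature.InformationTheory.QuantumCodes
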